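import Mathlib.Analysis.SpecialFunctions.Integrals.Basic
import Mathlib.MeasureTheory.Integral.IntervalIntegral.FundThmCalculus
import HarnessLib

/-!
# Route `PrimeLevelFamEdge`, crux K_A `MomentsBeyondDiagonal` (stmt-Parity-20007), line «petersson_layers» v4, stub `stub_diag`:
# **the zeroth Bose moment `μ₀ = ∫₀¹ v/(1+v²)² dv = 1/4`** (so `Π₀₀(L) = 2μ₀L = L/2`, `Π₀₁ = −L²/8 + …`, `Π₁₁ = L³/24 + …`)

Census R2/R3(ii), bridge item 5 of `Cruxes/MomentsBeyondDiagonal/Lines/petersson_layers_stub_diag_g10_blocks.md`: the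
polynomial parts `Π_ab(L)` of the Bose coefficients in `…DiagBoseMixedStructure.bose_coeff_structure` carry the moments
`μ_k = ∫₀¹(log v)^k·v/(1+v²)²dv` as unevaluated integrals; the leading coefficients of the order-`(1,1)` polynomial weight
(`L³/24`, `L/8` in `…DiagDecorOrderOneOnePoly`) need only `μ₀ = 1/4`:

* `integral_div_one_add_sq_sq` — `∫₀¹ v/(1+v²)² dv = 1/4` (antiderivative `−1/(2(1+v²))`);
* `setIntegral_Ioc_log_pow_zero_mul` — the literal instance `∫_{(0,1]} (log v)^0·(v/(1+v²)²) = 1/4` of the structure theorem.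

Def-free; theorems only. Helper `--supports stmt-Parity-20007`; closes nothing; K_A, K_B and the Parity summit are NOT proved;
nothing about Landau–Siegel zeros.

## References
* E. Kowalski, P. Michel, J. VanderKam, J. reine angew. Math. 526 (2000), (22)–(28) pp. 12–15.
  [cite: KowalskiMichelVanderKam2000, (22)–(28) — derivation (constants of the diagonal weight)]
-/

noncomputable section

open Real Set MeasureTheory intervalIntegral

namespace Summit.Parity.GeneralizedHardyLittlewood.Theorems.MomentsBeyondDiagonal.DiagLines

/-- **`∫₀¹ v/(1+v²)² dv = 1/4`.** [folklore] -/
theorem integral_div_one_add_sq_sq : ∫ v in (0 : ℝ)..1, v / (1 + v ^ 2) ^ 2 = 1 / 4 := by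
  have hderiv : ∀ x ∈ Set.uIcc (0 : ℝ) 1,
      HasDerivAt (fun v : ℝ ↦ -(1 / 2) * (1 + v ^ 2)⁻¹) (x / (1 + x ^ 2) ^ 2) x := by
    intro x _
    have hx : (1 + x ^ 2 : ℝ) ≠ 0 := by positivity
    have h1 : HasDerivAt (fun v : ℝ ↦ 1 + v ^ 2) (2 * x) x := by
      have h := (hasDerivAt_pow 2 x).const_add 1
      simpa using h
    have h2 := (h1.inv hx).const_mul (-(1 / 2) : ℝ)
    refine h2.congr_deriv ?_
    field_simp
  have hcont : ContinuousOn (fun v : ℝ ↦ v / (1 + v ^ 2) ^ 2) (Set.uIcc (0 : ℝ) 1) :=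
    (continuousOn_id.div ((continuousOn_const.add (continuousOn_id.pow 2)).pow 2)
      fun v _ ↦ by positivity)
  rw [integral_eq_sub_of_hasDerivAt hderiv (hcont.intervalIntegrable)]
  norm_num

/-- The literal instance `∫_{(0,1]} (log v)^0·(v/(1+v²)²) dv = 1/4` (`μ₀` of `bose_coeff_structure`). [folklore] -/
theorem setIntegral_Ioc_log_pow_zero_mul :
    ∫ v in Ioc (0 : ℝ) 1, Real.log v ^ 0 * (v / (1 + v ^ 2) ^ 2) = 1 / 4 := by
  simp only [pow_zero, one_mul]
  rw [← intervalIntegral.integral_of_le zero_le_one]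
  exact integral_div_one_add_sq_sq

/-- The same for the exponent written `0 + 0` (as instantiated at `a = b = 0`, `i = j = 0`). [folklore] -/
theorem setIntegral_Ioc_log_pow_zero_add_zero_mul :
    ∫ v in Ioc (0 : ℝ) 1, Real.log v ^ (0 + 0) * (v / (1 + v ^ 2) ^ 2) = 1 / 4 := by
  rw [Nat.add_zero]
  exact setIntegral_Ioc_log_pow_zero_mul

end Summit.Parity.GeneralizedHardyLittlewood.Theorems.MomentsBeyondDiagonal.DiagLines

end
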